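import Summits.ValiantsHypothesis.ValiantsHypothesis.Theses.VPBoundarySquare

/-!
# `VPBoundarySquare.Assembly` holds (bookkeeping item 23848 closed by proof)

The assembly item of route `VPBoundarySquare` (decomp-valiant workshop, lens 3) is the implication
`EmptyBoundarySeparates → CollapseEmptiesBoundary → ValiantsHypothesis` (Q → P → VP_ℂ ≠ VNP_ℂ),
which is literally the route's certified deciding theorem `closes` (D-0027 §2.1).  It is closed
here so that no decorative item remains open on the route (workshop critic, bus 527,
2026-08-30T07:57:31Z, principle (i)); the route's open content is unchanged: the declared residual
Q (`EmptyBoundarySeparates`), the attacked piece P (`CollapseEmptiesBoundary`, split) and the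
record asides.  No tag, no rung changes.
-/

set_option linter.dupNamespace false

namespace Summit.ValiantsHypothesis.ValiantsHypothesis.Theorems.VPBoundarySquareAssembly

/-- **Item 23848 (`VPBoundarySquare.Assembly`) holds**: `Q → P → VP_ℂ ≠ VNP_ℂ` is the route's
deciding theorem `closes` (if `VP = VNP` then P closes `VP` on p-families and Q then separates a
`VNP` family from the closure of `VP`, contradicting `VNP = VP ⊆ \overline{VP}`).
[cite: BurgisserEtAl2011, §9.3 (closure of VP)] -/
theorem assembly_holds :
    Summit.ValiantsHypothesis.ValiantsHypothesis.Theses.VPBoundarySquare.Assembly :=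
  fun hQ hP => Summit.ValiantsHypothesis.ValiantsHypothesis.Theses.VPBoundarySquare.closes hQ hP

end Summit.ValiantsHypothesis.ValiantsHypothesis.Theorems.VPBoundarySquareAssembly
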